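import Summits.BirchSwinnertonDyer.BirchSwinnertonDyer.Theorems.PrintCf2RubinValueTwoEllipticUnitsTwoVariableDivisionTwists
import HarnessLib

/-!
# The division twists for the two-variable moduli `𝔣 = 𝔪 v̄^{m+1}` WITHOUT `σ`-stability of `𝔪` and WITHOUT `w_𝔪 = 1`
# (de Shalit II.4.14 Step 1 / II.4.16: the moduli of a chain through ALL the primes of `S ∪ {𝔭̄}`, and the case `S = ∅`)

Cell `bsd-print-cf2`, width seat `bsd-line-cf2-p1-w8` g11 (input of the discharge of the two-variable measure along chains with varying
step primes, `…EllipticUnitsTwoVariableMeasureSteps`); `--supports` the banked S3a item stmt-BirchSwinnertonDyer-24721 (helper, Theses-free).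
THEOREMS ONLY; no named facts.

The sibling `…TwoVariableDivisionTwists.exists_divisionTwists_twoVariable` (p759029) produces the twists `𝔞₁ = (β^{2^m})`, `𝔞₂ = (σβ^{2^m})`,
`β = 1 + x`, for the modulus `𝔪 v̄^{m+1}` under TWO hypotheses that fail along the chains of II.4.16: `σ(𝔪) ⊆ 𝔪` (the intermediate moduli
`𝔤^a · ∏_{w ∈ S′} w · 𝔭̄^b`, `S′ ⊊ S`, of a one-prime-per-step chain are not conjugation-stable unless `S′` is) and `w_𝔪 = 1` (fails for
`𝔪 = 1`, the case `S = ∅`).  Both are used at exactly one point each: `σ(α₁ − 1) ∈ 𝔪`, and `β` not a unit.  THIS file removes them: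
choose `x ∈ (𝔪 ∩ σ⁻¹𝔪) ∩ v̄^{m+3} ∩ v² ∖ v³` (the ideal `𝔪 ⊓ 𝔪.comap σ` still avoids `v`, because `𝔪 ⊄ v` and `𝔪 ⊄ v̄ = σv`), so that
`σx ∈ 𝔪` directly, and ask `w_{𝔪v̄²} = 1` instead of `w_𝔪 = 1` (`x ∈ 𝔪 ∩ v̄² `; for an imaginary quadratic `K` with `2` split, `−2 ∉ v̄²`):

* ★★ `exists_divisionTwists_twoVariable_general` — the conclusion of the sibling VERBATIM, hypotheses `h𝔪σ` dropped and `hw` weakened to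
  `∀ u, u − 1 ∈ 𝔪·v̄² → u = 1`.

HONEST FRAMING: elementary 2-adic / ideal bookkeeping over the sibling's lemmas; nothing here closes a crux; BSD is not proved by any of this.

## References
* [deShalit1987] E. de Shalit, *Iwasawa theory of elliptic curves with complex multiplication* (1987), II.4.12 (p. 66–68), II.4.14 Step 1
  (p. 71), II.4.16 (p. 76), II.4.17 (p. 78).
* [NeukirchANT1999] J. Neukirch, *Algebraic Number Theory* (1999), Ch. I §3 (3.1), Ch. II §5.
-/

-- the summit namespace `Summit.BirchSwinnertonDyer.BirchSwinnertonDyer` repeats the problem name by design (D-0017)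
set_option linter.dupNamespace false
set_option autoImplicit false

noncomputable section

open scoped Classical nonZeroDivisors NumberField
open IsDedekindDomain IsDedekindDomain.HeightOneSpectrum Finset
open Literature.NumberTheory.NumberFields
open Summit.BirchSwinnertonDyer.BirchSwinnertonDyer.Theorems.PrintCf2.EllipticUnitsLocal

namespace Summit.BirchSwinnertonDyer.BirchSwinnertonDyer.Theorems.PrintCf2.EllipticUnitsTwoVariable

variable {K : Type} [Field K] [NumberField K] {𝔪 : Ideal (𝓞 K)} {v v' : HeightOneSpectrum (𝓞 K)}

omit [NumberField K] in
/-- **`𝔪 ∩ σ⁻¹(𝔪)` avoids `v`** when `𝔪 ⊄ v`, `𝔪 ⊄ v'` and `σ(v) ⊆ v'` (`σ` an involution): `σ⁻¹𝔪 ⊆ v` would give `𝔪 ⊆ σ(v) ⊆ v'`.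
[cite: NeukirchANT1999, Ch. I §3 (3.1)] -/
theorem not_inf_comap_le (hv : ¬ 𝔪 ≤ v.asIdeal) (hv'𝔪 : ¬ 𝔪 ≤ v'.asIdeal) (σ : 𝓞 K ≃+* 𝓞 K) (hσσ : ∀ a, σ (σ a) = a)
    (hσv : ∀ y ∈ v.asIdeal, σ y ∈ v'.asIdeal) : ¬ 𝔪 ⊓ 𝔪.comap (σ : 𝓞 K →+* 𝓞 K) ≤ v.asIdeal := by
  intro h
  rcases v.isPrime.inf_le.mp h with h1 | h2
  · exact hv h1
  · refine hv'𝔪 fun y hy ↦ ?_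
    have h3 : σ y ∈ v.asIdeal := h2 (by rw [Ideal.mem_comap, RingEquiv.coe_toRingHom, hσσ]; exact hy)
    simpa [hσσ] using hσv _ h3

/-- ★★ **THE DIVISION TWISTS FOR THE TWO-VARIABLE MODULI `𝔣_m = 𝔪 v'^{m+1}`, `𝔪` ARBITRARY (not `σ`-stable, `w_𝔪` unrestricted)** (de Shalit II.4.14 Step 1: the auxiliary `𝔞` for
`𝔣 = 𝔤𝔭̄^m`).  Let `σ` be an involution of `𝒪_K` with `N(a) = a·σa`, `v' ≠ v` with `σ(v') ⊆ v` AND `σ(v) ⊆ v'` (`v' = v̄`),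
`𝒪_v ≅ ℤ₂`, `v ∤ 𝔪`, `v' ∤ 𝔪`, `w_{𝔪v'²} = 1`.  Then for every `m` there are `α₁, α₂ = σα₁ ∈ 𝒪_K`, non-zero, `≡ 1 mod 𝔪 v'^{m+1}`,
`((αᵢ), 𝔪 v'^{m+1} v) = 1`, with `α₁ − 1 ∈ v^{(m+1)+1} ∖ v^{(m+1)+2}`, `α₂ − 1 ∈ v^{(m+1)+1}`, `α₂ᵏ ≠ α₁ᵏ` in `K_v` for all `k > 0`, `N(α₁) ≥ 2`,
`4 ∣ N(α₁) − 1`, `N(α₂) = N(α₁)` — ALL the arithmetic hypotheses at the modulus `𝔣_m` and the level `s_m = m + 1` of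
`…EllipticUnitsTwoVariableMeasure.exists_twoVariable_groupDistribution_ellipticUnitsGlobal_of_principal`
(`α₁ = (1 + x)^{2^m}`, `x ∈ 𝔪 ∩ σ⁻¹𝔪 ∩ v'^{m+3} ∩ v² ∖ v³`; `2² ∥ 1 + x − 1 ⟹ 2^{m+2} ∥ α₁ − 1`).
[cite: deShalit1987, II.4.14 Step 1 (p. 71), II.4.16 (p. 76), II.4.12 (p. 66–68), II.4.17 (p. 78)] -/
theorem exists_divisionTwists_twoVariable_general (hv : ¬ 𝔪 ≤ v.asIdeal) (hv'𝔪 : ¬ 𝔪 ≤ v'.asIdeal)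
    (hw : ∀ u : (𝓞 K)ˣ, (u : 𝓞 K) - 1 ∈ 𝔪 * v'.asIdeal ^ 2 → u = 1)
    (e₂ : v.adicCompletionIntegers K ≃+* ℤ_[2]) (σ : 𝓞 K ≃+* 𝓞 K) (hσσ : ∀ a, σ (σ a) = a)
    (hv' : v' ≠ v) (hσv' : ∀ y ∈ v'.asIdeal, σ y ∈ v.asIdeal) (hσv : ∀ y ∈ v.asIdeal, σ y ∈ v'.asIdeal)
    (hnorm : ∀ a : 𝓞 K, ((Ideal.absNorm (Ideal.span {a}) : ℕ) : 𝓞 K) = a * σ a) (m : ℕ) :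
    ∃ α₁ α₂ : 𝓞 K, α₁ ≠ 0 ∧ α₂ ≠ 0 ∧ α₁ - 1 ∈ 𝔪 * v'.asIdeal ^ (m + 1) ∧ α₂ - 1 ∈ 𝔪 * v'.asIdeal ^ (m + 1) ∧
      IsCoprime (Ideal.span {α₁}) (𝔪 * v'.asIdeal ^ (m + 1) * v.asIdeal) ∧
      IsCoprime (Ideal.span {α₂}) (𝔪 * v'.asIdeal ^ (m + 1) * v.asIdeal) ∧
      α₁ - 1 ∈ v.asIdeal ^ ((m + 1) + 1) ∧ α₁ - 1 ∉ v.asIdeal ^ ((m + 1) + 2) ∧ α₂ - 1 ∈ v.asIdeal ^ ((m + 1) + 1) ∧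
      (∀ k : ℕ, 0 < k → ((α₂ : K) : v.adicCompletion K) ^ k ≠ ((α₁ : K) : v.adicCompletion K) ^ k) ∧
      2 ≤ Ideal.absNorm (Ideal.span {α₁}) ∧ 4 ∣ Ideal.absNorm (Ideal.span {α₁}) - 1 ∧
      Ideal.absNorm (Ideal.span {α₂}) = Ideal.absNorm (Ideal.span {α₁}) := by
  obtain ⟨x, hx𝔪', hxv', hxv2, hxv3⟩ :=
    exists_mem_mem_pow_mem_sq_not_mem_cube (not_inf_comap_le hv hv'𝔪 σ hσσ hσv) hv' (m + 3)
  have hx𝔪 : x ∈ 𝔪 := (Ideal.mem_inf.mp hx𝔪').1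
  have hσx𝔪 : σ x ∈ 𝔪 := by
    have h := (Ideal.mem_inf.mp hx𝔪').2
    rwa [Ideal.mem_comap, RingEquiv.coe_toRingHom] at h
  -- images under `σ`
  have hmapσ : ∀ (I J : Ideal (𝓞 K)), (∀ y ∈ I, σ y ∈ J) → ∀ (n : ℕ) {y : 𝓞 K}, y ∈ I ^ n → σ y ∈ J ^ n := by
    intro I J hIJ n y hy
    have h1 : Ideal.map σ I ≤ J := Ideal.map_le_iff_le_comap.mpr fun z hz ↦ hIJ z hz
    have h2 := Ideal.mem_map_of_mem (σ : 𝓞 K →+* 𝓞 K) hy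
    rw [Ideal.map_pow] at h2
    exact Ideal.pow_right_mono h1 n h2
  have hσx : σ x ∈ v.asIdeal ^ (m + 3) := hmapσ _ _ hσv' _ hxv'
  have hσx3 : σ x ∈ v.asIdeal ^ 3 := Ideal.pow_le_pow_right (by omega) hσx
  have hσx2 : σ x ∈ v.asIdeal ^ 2 := Ideal.pow_le_pow_right (by omega) hσx
  set β : 𝓞 K := 1 + x with hβ
  have hβ1 : β - 1 = x := by rw [hβ]; ring
  have hσβ : σ β = 1 + σ x := by rw [hβ, map_add, map_one]
  have hσβ1 : σ β - 1 = σ x := by rw [hσβ]; ring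
  set α₁ : 𝓞 K := β ^ 2 ^ m with hα₁
  set α₂ : 𝓞 K := σ α₁ with hα₂
  have hα₂' : α₂ = (σ β) ^ 2 ^ m := by rw [hα₂, hα₁, map_pow]
  -- the reading in `ℤ₂`
  set rd : 𝓞 K →+* ℤ_[2] := (e₂ : v.adicCompletionIntegers K →+* ℤ_[2]).comp (algebraMap (𝓞 K) (v.adicCompletionIntegers K))
    with hrd
  have hrd1 : ∀ (y : 𝓞 K) (n : ℕ), y - 1 ∈ v.asIdeal ^ n ↔ (2 : ℤ_[2]) ^ n ∣ rd y - 1 := by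
    intro y n
    rw [← map_one rd, ← map_sub, hrd, ← mem_pow_iff_two_pow_dvd_toPadicInt e₂]
  have hβ2 : (2 : ℤ_[2]) ^ 2 ∣ rd β - 1 := (hrd1 β 2).mp (hβ1 ▸ hxv2)
  have hβ3 : ¬ (2 : ℤ_[2]) ^ 3 ∣ rd β - 1 := fun h ↦ hxv3 (hβ1 ▸ (hrd1 β 3).mpr h)
  have hσβ3 : (2 : ℤ_[2]) ^ 3 ∣ rd (σ β) - 1 := (hrd1 (σ β) 3).mp (hσβ1 ▸ hσx3)
  -- `2^{m+2} ∥ α₁ − 1`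
  obtain ⟨hex1, hex2⟩ := exact_pow_two_pow hβ2 hβ3 m
  have hα₁v : α₁ - 1 ∈ v.asIdeal ^ (m + 1 + 1) := by
    rw [hrd1, hα₁, map_pow, show m + 1 + 1 = 2 + m by omega]; exact hex1
  have hα₁v' : α₁ - 1 ∉ v.asIdeal ^ (m + 1 + 2) := by
    rw [hrd1, hα₁, map_pow, show m + 1 + 2 = 2 + m + 1 by omega]; exact hex2
  -- memberships modulo `𝔪`, `v'^{m+1}`
  have hα₁𝔪 : α₁ - 1 ∈ 𝔪 := pow_sub_one_mem (hβ1 ▸ hx𝔪) _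
  have hα₁P : α₁ - 1 ∈ v'.asIdeal ^ (m + 1) := Ideal.pow_le_pow_right (by omega) (pow_sub_one_mem (hβ1 ▸ hxv') (2 ^ m))
  have hα₂eq : α₂ - 1 = σ (α₁ - 1) := by rw [hα₂, map_sub, map_one]
  have hα₂𝔪 : α₂ - 1 ∈ 𝔪 := by rw [hα₂']; exact pow_sub_one_mem (hσβ1 ▸ hσx𝔪) _
  have hα₂P : α₂ - 1 ∈ v'.asIdeal ^ (m + 1) := by
    rw [hα₂eq]; exact Ideal.pow_le_pow_right (by omega) (hmapσ _ _ hσv (m + 1 + 1) hα₁v)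
  have hα₂v : α₂ - 1 ∈ v.asIdeal ^ (m + 1 + 1) := by
    rw [hα₂eq]
    exact Ideal.pow_le_pow_right (by omega) (hmapσ _ _ hσv' (m + 3) (pow_sub_one_mem (hβ1 ▸ hxv') (2 ^ m)))
  -- non-vanishing, non-unit
  have hv1 : (1 : 𝓞 K) ∉ v.asIdeal := fun h ↦ v.isPrime.ne_top ((Ideal.eq_top_iff_one _).mpr h)
  have hβ0 : β ≠ 0 := by
    intro h
    have : x = -1 := by rw [hβ] at h; linear_combination h
    exact hv1 (by simpa [this] using (v.asIdeal.neg_mem (Ideal.pow_le_self two_ne_zero hxv2)))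
  have hα₁0 : α₁ ≠ 0 := pow_ne_zero _ hβ0
  have hα₂0 : α₂ ≠ 0 := by rw [hα₂]; exact (map_ne_zero_iff _ σ.injective).mpr hα₁0
  have hNβ0 : Ideal.absNorm (Ideal.span {β}) ≠ 0 := by
    rw [Ne, Ideal.absNorm_eq_zero_iff, Ideal.span_singleton_eq_bot]; exact hβ0
  have hNβ1 : Ideal.absNorm (Ideal.span {β}) ≠ 1 := by
    rw [Ne, Ideal.absNorm_eq_one_iff, Ideal.span_singleton_eq_top]
    intro hu
    have := hw hu.unit (by rw [IsUnit.unit_spec, hβ1]; exact mem_mul_of_mem_of_mem hv'𝔪 2 hx𝔪 (Ideal.pow_le_pow_right (by omega) hxv'))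
    have hx0 : x = 0 := by
      have h' : (hu.unit : 𝓞 K) = 1 := by rw [this, Units.val_one]
      rw [IsUnit.unit_spec, hβ] at h'; linear_combination h'
    exact hxv3 (by rw [hx0]; exact Submodule.zero_mem _)
  -- the norms
  have hNβ : 2 ≤ Ideal.absNorm (Ideal.span {β}) := by omega
  have hN₁ : Ideal.absNorm (Ideal.span {α₁}) = Ideal.absNorm (Ideal.span {β}) ^ 2 ^ m := absNorm_span_singleton_pow β _
  have hNeq : Ideal.absNorm (Ideal.span {α₂}) = Ideal.absNorm (Ideal.span {α₁}) := by
    have h := hnorm α₂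
    rw [hα₂, hσσ, mul_comm, ← hα₂, ← hnorm α₁] at h
    exact_mod_cast h
  have h4β : (4 : ℤ) ∣ (Ideal.absNorm (Ideal.span {β}) : ℤ) - 1 := by
    apply four_dvd_of_intCast_mem_sq e₂
    have hc : (((Ideal.absNorm (Ideal.span {β}) : ℤ) - 1 : ℤ) : 𝓞 K) = β * σ β - 1 := by
      push_cast; rw [hnorm β]
    rw [hc, show β * σ β - 1 = x + σ x + x * σ x by rw [hσβ, hβ]; ring]
    exact Submodule.add_mem _ (Submodule.add_mem _ hxv2 hσx2) (Ideal.mul_mem_left _ _ hσx2)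
  have h4β' : 4 ∣ Ideal.absNorm (Ideal.span {β}) - 1 := by
    have hN1' : 1 ≤ Ideal.absNorm (Ideal.span {β}) := Nat.one_le_iff_ne_zero.mpr hNβ0
    have h4'' : ((4 : ℕ) : ℤ) ∣ ((Ideal.absNorm (Ideal.span {β}) - 1 : ℕ) : ℤ) := by
      rw [Nat.cast_sub hN1', Nat.cast_one]; exact_mod_cast h4β
    exact Int.natCast_dvd_natCast.mp h4''
  refine ⟨α₁, α₂, hα₁0, hα₂0, mem_mul_of_mem_of_mem hv'𝔪 _ hα₁𝔪 hα₁P, mem_mul_of_mem_of_mem hv'𝔪 _ hα₂𝔪 hα₂P,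
    ((isCoprime_span_singleton_of_sub_one_mem hα₁𝔪).mul_right (isCoprime_span_singleton_of_sub_one_mem hα₁P)).mul_right
      (isCoprime_span_singleton_of_sub_one_mem (Ideal.pow_le_self (by omega) hα₁v)),
    ((isCoprime_span_singleton_of_sub_one_mem hα₂𝔪).mul_right (isCoprime_span_singleton_of_sub_one_mem hα₂P)).mul_right
      (isCoprime_span_singleton_of_sub_one_mem (Ideal.pow_le_self (by omega) hα₂v)),
    hα₁v, hα₁v', hα₂v, fun k hk heq ↦ ?_, ?_, ?_, hNeq⟩
  · -- `α₂ᵏ = α₁ᵏ` in `K_v` ⟹ `rd(σβ)^{2^m k} = rd(β)^{2^m k}`, against `pow_ne_pow_of_two_adic`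
    have hk' := toPadicInt_pow_eq_of_coe_pow_eq e₂ heq
    rw [← hrd, hα₂', hα₁, map_pow, map_pow, ← pow_mul, ← pow_mul] at hk'
    exact pow_ne_pow_of_two_adic hβ2 hβ3 hσβ3 (Nat.mul_pos (Nat.two_pow_pos m) hk) hk'.symm
  · rw [hN₁]; exact le_trans hNβ (Nat.le_self_pow (pow_ne_zero m two_ne_zero) _)
  · rw [hN₁]
    have h := Nat.sub_dvd_pow_sub_pow (Ideal.absNorm (Ideal.span {β})) 1 (2 ^ m)
    rw [one_pow] at h
    exact dvd_trans h4β' h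

end Summit.BirchSwinnertonDyer.BirchSwinnertonDyer.Theorems.PrintCf2.EllipticUnitsTwoVariable

end
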